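import Mathlib.Topology.Homotopy.Lifting
import Mathlib.AlgebraicTopology.FundamentalGroupoid.SimplyConnected
import Mathlib.Topology.Algebra.ConstMulAction
import Mathlib.GroupTheory.Index
import Literature.Topology.CoveringSpaces.CoveringMapOfComp
import HarnessLib

/-!
# Connected coverings of a quotient `M/Γ` of a simply connected space are the quotients `M/Λ`, `Λ ≤ Γ`
# (PROOF-ONLY; Hatcher §1.3, Prop. 1.36 / Thm. 1.38 surjectivity half / Ex. 24)

Topic `Literature/Topology/CoveringSpaces`.  The «essential surjectivity» companion of the lifting
theorem `UniformizedCoverLiftPSL2R` (abc-iut campaign-L R1.2, the `Loc(N, Γ) ⥤ HolRS` junction of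
[AbsTopIII] §4): every connected covering of a space uniformised as `M/Γ` is itself uniformised by `M`,
as `M/Λ` for a subgroup `Λ ≤ Γ`, compatibly with the projections.

SETTING (the same «deck/orbit» presentation as `UniformizedLift.mem_or_neg_mem_of_deck`, so that
`N = SL(2, ℝ)`, `M = ℍ` is an instance): a group `N` acts on a simply connected, locally path connected
space `M` by homeomorphisms; `π : M → X` is a covering map on which a subgroup `Γ ≤ N` acts by deck
transformations (`π (γ • m) = π m`) TRANSITIVELY on the fibres (`π m = π m' → ∃ γ ∈ Γ, γ • m = m'`) — e.g.
`X = M/Γ` for a free properly discontinuous action, or `X = ℍ/Γ` with `Γ ∋ -1`; and `p : Y → X` is a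
covering map with `Y` connected.  Hatcher, Thm. 1.38: «path-connected covering spaces … correspond to
conjugacy classes of subgroups of `π₁(X)`», realised (p. 68, Prop. 1.36 and Ex. 24) as the quotients
`X̃/H` of the universal cover; here `M` plays `X̃` and `Γ` plays `π₁(X)` (up to the kernel of the
action), without identifying either.

* `SimplyConnectedCover.exists_lift` — a lift `k : M → Y`, `p ∘ k = π`, through any base points
  (Mathlib's lifting criterion), a covering map (`IsCoveringMap.of_comp_eq`), onto `Y`;
* `forall_apply_smul_eq_of_apply_smul_eq` — ONE-POINT CRITERION: `γ ∈ Γ` with `k (γ • m₁) = k m₁` for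
  one `m₁` satisfies it for all `m` (uniqueness of lifts);
* `apply_eq_apply_iff` — the fibres of `k` are the orbits of the STABILISER
  `Λ = {γ ∈ Γ | k (γ • ·) = k}`;
* **`exists_subgroup_homeomorph_orbitQuotient`** — `Y ≃ₜ M/Λ` over `X`, based: there are `Λ ≤ Γ`, the
  lift `k`, and a homeomorphism `e : M/Λ ≃ₜ Y` with `e [m] = k m`, `p (e [m]) = π m`, `e [m₀] = y₀`;
* `finiteIndex_of_finite_fibre` — if the fibre of `p` over `π m₀` is finite, `Λ` has finite index in
  `Γ` (`γΛ ↦ k (γ⁻¹ • m₀)` injects `Γ/Λ` into the fibre).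

Everything is a theorem; no definition (the subgroup `Λ` is produced inside the existential with its
membership criterion), no named fact.  Nothing here is specific to the abc-iut cell.

## References

* A. Hatcher, *Algebraic Topology*, CUP (2002), §1.3 Prop. 1.33, 1.34, 1.36, Thm. 1.38, Ex. 24.
  [HatcherAT2002]
-/

noncomputable section

namespace Literature.Topology.CoveringSpaces

open _root_.Topology _root_.Set _root_.Function _root_.Filter _root_.MulAction

namespace SimplyConnectedCover

variable {N : Type*} [Group N] {M : Type*} [TopologicalSpace M] [MulAction N M]
  {X : Type*} [TopologicalSpace X] {Y : Type*} [TopologicalSpace Y]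
  {π : M → X} {Γ : Subgroup N} {p : Y → X}

/-! ### §1 The lift of the uniformisation through a covering -/

/-- The complement of the image of a covering map is open (a point outside the image has an evenly
covered neighbourhood with empty fibre); cf. the tree's `IsCoveringMap.isClosed_range`
(`Geometry/Lorentzian/AFEndCovering`), restated here to keep the imports topological. [folklore] -/
private theorem isClosed_range_of_isCoveringMap {k : M → Y} (hk : IsCoveringMap k) :
    IsClosed (range k) := by
  rw [← isOpen_compl_iff, isOpen_iff_forall_mem_open]
  intro y hy
  obtain ⟨-, U, hyU, hU, -, H, -⟩ := hk y
  refine ⟨U, fun y' hy' hy'r => ?_, hU, hyU⟩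
  obtain ⟨w, hw⟩ := hy'r
  have hwU : w ∈ k ⁻¹' U := by rw [mem_preimage, hw]; exact hy'
  obtain ⟨w', hw'⟩ := (H ⟨w, hwU⟩).2
  exact hy ⟨w', hw'⟩

/-- **The lift of the uniformisation** (Hatcher Prop. 1.33 for the simply connected `M`, Ex. 16 for
the covering property, connectedness of `Y` for surjectivity): for covering maps `π : M → X`,
`p : Y → X` with `M` simply connected and locally path connected, `X` locally connected, `Y` connected,
and base points `p y₀ = π m₀`, there is a SURJECTIVE covering map `k : M → Y` with `p ∘ k = π` and
`k m₀ = y₀`. [cite: HatcherAT2002, §1.3 Prop. 1.33 and Exercise 16] -/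
theorem exists_lift [SimplyConnectedSpace M] [LocallyPathConnectedSpace M] [LocallyConnectedSpace X]
    [ConnectedSpace Y] (hπ : IsCoveringMap π) (hp : IsCoveringMap p) {m₀ : M} {y₀ : Y}
    (h0 : p y₀ = π m₀) :
    ∃ k : M → Y, IsCoveringMap k ∧ Surjective k ∧ (∀ m, p (k m) = π m) ∧ k m₀ = y₀ := by
  obtain ⟨K, ⟨hK0, hK⟩, -⟩ :=
    hp.existsUnique_continuousMap_lifts (⟨π, hπ.continuous⟩ : C(M, X)) m₀ y₀ h0
  have hK' : ∀ m, p (K m) = π m := fun m => congr_fun hK m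
  have hk : IsCoveringMap K := IsCoveringMap.of_comp_eq hπ hp K.continuous hK'
  refine ⟨K, hk, ?_, hK', hK0⟩
  have hclopen : IsClopen (range K) :=
    ⟨isClosed_range_of_isCoveringMap hk, hk.isLocalHomeomorph.isOpenMap.isOpen_range⟩
  rw [← range_eq_univ]
  exact hclopen.eq_univ ⟨K m₀, m₀, rfl⟩

/-- **One-point criterion** (uniqueness of lifts, Hatcher Prop. 1.34): if `γ ∈ Γ` acts as a deck
transformation of `π` and a lift `k` of `π` through the covering `p` satisfies `k (γ • m₁) = k m₁` at ONE
point, then `k (γ • m) = k m` for all `m` (`k ∘ (γ • ·)` and `k` are lifts of `π` agreeing at `m₁`).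
[cite: HatcherAT2002, §1.3 Prop. 1.34] -/
theorem forall_apply_smul_eq_of_apply_smul_eq [PreconnectedSpace M] [ContinuousConstSMul N M]
    (hp : IsCoveringMap p) {k : M → Y} (hk : Continuous k) (hpk : ∀ m, p (k m) = π m)
    (hdeck : ∀ γ ∈ Γ, ∀ m, π (γ • m) = π m) {γ : N} (hγ : γ ∈ Γ) {m₁ : M}
    (h : k (γ • m₁) = k m₁) (m : M) : k (γ • m) = k m := by
  have := hp.eq_of_comp_eq (hk.comp (continuous_const_smul γ)) hk
    (funext fun m => by
      show p (k (γ • m)) = p (k m)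
      rw [hpk, hpk, hdeck γ hγ]) m₁ h
  exact congr_fun this m

/-- **The fibres of the lift are the orbits of the stabiliser**: for `γ`-s in `Γ` acting by deck
transformations transitively on the fibres of `π`, two points have the same image under the lift `k`
iff they differ by some `γ ∈ Γ` with `k ∘ (γ • ·) = k`. [cite: HatcherAT2002, §1.3 Prop. 1.34 and Exercise 24] -/
theorem apply_eq_apply_iff [PreconnectedSpace M] [ContinuousConstSMul N M] (hp : IsCoveringMap p)
    {k : M → Y} (hk : Continuous k) (hpk : ∀ m, p (k m) = π m)
    (hdeck : ∀ γ ∈ Γ, ∀ m, π (γ • m) = π m) (horb : ∀ m m', π m = π m' → ∃ γ ∈ Γ, γ • m = m')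
    (m m' : M) :
    k m = k m' ↔ ∃ γ ∈ Γ, (∀ x, k (γ • x) = k x) ∧ γ • m = m' := by
  constructor
  · intro h
    obtain ⟨γ, hγ, rfl⟩ := horb m m' (by rw [← hpk, ← hpk, h])
    exact ⟨γ, hγ, forall_apply_smul_eq_of_apply_smul_eq hp hk hpk hdeck hγ h.symm, rfl⟩
  · rintro ⟨γ, -, hγk, rfl⟩
    exact (hγk m).symm

/-! ### §2 Connected coverings of `M/Γ` are quotients `M/Λ`, `Λ ≤ Γ` -/

/-- **Connected coverings of a quotient of a simply connected space are quotients by subgroups**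
(Hatcher Thm. 1.38 / Prop. 1.36 / Ex. 24, in the presentation «`Γ ≤ N` acts on the covering
`π : M → X` by deck transformations transitively on the fibres»): for every connected covering
`p : Y → X` and base points `p y₀ = π m₀` there are a subgroup `Λ ≤ Γ` — the stabiliser of the lift `k`,
with the membership criterion `γ ∈ Λ ↔ γ ∈ Γ ∧ k ∘ (γ • ·) = k` — and a homeomorphism
`e : M/Λ ≃ₜ Y` OVER `X` (`p (e [m]) = π m`) with `e [m] = k m` and `e [m₀] = y₀`; the fibres of `k` are
exactly the `Λ`-orbits. [cite: HatcherAT2002, §1.3 Theorem 1.38 and Exercise 24] -/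
theorem exists_subgroup_homeomorph_orbitQuotient [SimplyConnectedSpace M] [LocallyPathConnectedSpace M]
    [ContinuousConstSMul N M] [LocallyConnectedSpace X] [ConnectedSpace Y]
    (hπ : IsCoveringMap π) (hdeck : ∀ γ ∈ Γ, ∀ m, π (γ • m) = π m)
    (horb : ∀ m m', π m = π m' → ∃ γ ∈ Γ, γ • m = m') (hp : IsCoveringMap p)
    {m₀ : M} {y₀ : Y} (h0 : p y₀ = π m₀) :
    ∃ (Λ : Subgroup N) (k : M → Y) (e : orbitRel.Quotient Λ M ≃ₜ Y),
      Λ ≤ Γ ∧ IsCoveringMap k ∧ (∀ m, p (k m) = π m) ∧ k m₀ = y₀ ∧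
      (∀ γ, γ ∈ Λ ↔ γ ∈ Γ ∧ ∀ m, k (γ • m) = k m) ∧
      (∀ m m', k m = k m' ↔ ∃ γ ∈ Λ, γ • m = m') ∧
      (∀ m, e (Quotient.mk _ m) = k m) ∧ (∀ m, p (e (Quotient.mk _ m)) = π m) ∧
      e (Quotient.mk _ m₀) = y₀ := by
  obtain ⟨k, hk, hksurj, hpk, hk0⟩ := exists_lift hπ hp h0
  -- the stabiliser of `k` inside `Γ`
  let Λ : Subgroup N :=
    { carrier := {γ | γ ∈ Γ ∧ ∀ m, k (γ • m) = k m}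
      mul_mem' := fun {a b} ha hb => ⟨Γ.mul_mem ha.1 hb.1, fun m => by rw [mul_smul, ha.2, hb.2]⟩
      one_mem' := ⟨Γ.one_mem, fun m => by rw [one_smul]⟩
      inv_mem' := fun {a} ha => ⟨Γ.inv_mem ha.1, fun m => by
        conv_rhs => rw [← smul_inv_smul a m]
        exact (ha.2 _).symm⟩ }
  have hΛ : ∀ γ, γ ∈ Λ ↔ γ ∈ Γ ∧ ∀ m, k (γ • m) = k m := fun γ => Iff.rfl
  have hfib : ∀ m m', k m = k m' ↔ ∃ γ ∈ Λ, γ • m = m' := fun m m' => by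
    rw [apply_eq_apply_iff hp hk.continuous hpk hdeck horb m m']
    simp only [hΛ]
    constructor
    · rintro ⟨γ, hγ, hγk, h⟩; exact ⟨γ, ⟨hγ, hγk⟩, h⟩
    · rintro ⟨γ, ⟨hγ, hγk⟩, h⟩; exact ⟨γ, hγ, hγk, h⟩
  -- `k` descends to a continuous bijection `M/Λ → Y`, open because `k` is
  haveI : ContinuousConstSMul Λ M := ⟨fun γ => continuous_const_smul (γ : N)⟩
  have hresp : ∀ a b : M, (orbitRel Λ M) a b → k a = k b := by
    intro a b hab
    rw [orbitRel_apply, mem_orbit_iff] at hab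
    obtain ⟨γ, rfl⟩ := hab
    exact ((hΛ γ).1 γ.2).2 b
  let kbar : orbitRel.Quotient Λ M → Y := Quotient.lift k hresp
  have hkbar : ∀ m, kbar (Quotient.mk _ m) = k m := fun m => rfl
  have hkbar_cont : Continuous kbar := hk.continuous.quotient_lift hresp
  have hkbar_bij : Bijective kbar := by
    refine ⟨fun a b hab => ?_, fun y => ?_⟩
    · induction a using Quotient.inductionOn with | h a => ?_
      induction b using Quotient.inductionOn with | h b => ?_
      change k a = k b at hab
      obtain ⟨γ, hγ, rfl⟩ := (hfib a b).1 hab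
      refine Quotient.sound ?_
      change a ∈ orbit (↥Λ) (γ • a)
      rw [mem_orbit_iff]
      refine ⟨⟨γ⁻¹, Λ.inv_mem hγ⟩, ?_⟩
      show (γ⁻¹ : N) • γ • a = a
      rw [inv_smul_smul]
    · obtain ⟨m, rfl⟩ := hksurj y
      exact ⟨Quotient.mk _ m, rfl⟩
  have hkbar_open : IsOpenMap kbar := by
    intro V hV
    have : kbar '' V = k '' (Quotient.mk (orbitRel Λ M) ⁻¹' V) := by
      ext y
      constructor
      · rintro ⟨q, hq, rfl⟩
        induction q using Quotient.inductionOn with | h m => exact ⟨m, hq, rfl⟩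
      · rintro ⟨m, hm, rfl⟩
        exact ⟨Quotient.mk _ m, hm, rfl⟩
    rw [this]
    exact hk.isLocalHomeomorph.isOpenMap _ (hV.preimage continuous_quot_mk)
  let e : orbitRel.Quotient Λ M ≃ₜ Y :=
    (Equiv.ofBijective kbar hkbar_bij).toHomeomorphOfContinuousOpen hkbar_cont hkbar_open
  have he : ∀ q, e q = kbar q := fun q => rfl
  refine ⟨Λ, k, e, fun γ hγ => ((hΛ γ).1 hγ).1, hk, hpk, hk0, hΛ, hfib, fun m => ?_, fun m => ?_, ?_⟩
  · rw [he, hkbar]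
  · rw [he, hkbar, hpk]
  · rw [he, hkbar, hk0]

/-- **Finite fibres give finite index**: in the situation of `exists_subgroup_homeomorph_orbitQuotient`
(a lift `k` of `π` through `p`, `Λ ≤ Γ` its stabiliser given by the membership criterion), if the
fibre of `p` over `π m₀` is finite then `Λ` has finite index in `Γ`: `γΛ ↦ k (γ⁻¹ • m₀)` injects the coset
space into that fibre (no freeness of the action is needed — the one-point criterion absorbs
stabilisers). [cite: HatcherAT2002, §1.3 Exercise 24] -/
theorem finiteIndex_of_finite_fibre [PreconnectedSpace M] [ContinuousConstSMul N M]
    (hp : IsCoveringMap p) {k : M → Y} (hk : Continuous k) (hpk : ∀ m, p (k m) = π m)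
    (hdeck : ∀ γ ∈ Γ, ∀ m, π (γ • m) = π m) {Λ : Subgroup N}
    (hΛ : ∀ γ, γ ∈ Λ ↔ γ ∈ Γ ∧ ∀ m, k (γ • m) = k m) (m₀ : M)
    (hfin : (p ⁻¹' {π m₀}).Finite) : (Λ.subgroupOf Γ).FiniteIndex := by
  haveI : Finite (p ⁻¹' {π m₀}) := hfin.to_subtype
  -- `γΛ ↦ k (γ⁻¹ • m₀)` is a well defined injection `Γ/Λ → p⁻¹(π m₀)`
  let F : Γ ⧸ Λ.subgroupOf Γ → p ⁻¹' {π m₀} :=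
    Quotient.lift (fun γ : Γ => (⟨k ((γ : N)⁻¹ • m₀), by
        rw [mem_preimage, hpk, mem_singleton_iff]; exact hdeck _ (Γ.inv_mem γ.2) m₀⟩ : p ⁻¹' {π m₀}))
      (by
        intro a b hab
        apply Subtype.ext
        have hab' : a⁻¹ * b ∈ Λ.subgroupOf Γ := QuotientGroup.leftRel_apply.mp hab
        rw [Subgroup.mem_subgroupOf, Subgroup.coe_mul, Subgroup.coe_inv] at hab'
        show k ((a : N)⁻¹ • m₀) = k ((b : N)⁻¹ • m₀)
        have h1 : ((a : N)⁻¹ * b) • ((b : N)⁻¹ • m₀) = (a : N)⁻¹ • m₀ := by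
          rw [← mul_smul, mul_assoc, mul_inv_cancel, mul_one]
        rw [← h1, ((hΛ _).1 hab').2])
  have hF : Injective F := by
    intro a b hab
    induction a using Quotient.inductionOn with | h a => ?_
    induction b using Quotient.inductionOn with | h b => ?_
    have hab' : k ((a : N)⁻¹ • m₀) = k ((b : N)⁻¹ • m₀) := congrArg Subtype.val hab
    apply Quotient.sound
    apply QuotientGroup.leftRel_apply.mpr
    rw [Subgroup.mem_subgroupOf, Subgroup.coe_mul, Subgroup.coe_inv]
    -- one-point criterion at `m₁ = b⁻¹ • m₀`
    have key : k (((a : N)⁻¹ * b) • ((b : N)⁻¹ • m₀)) = k ((b : N)⁻¹ • m₀) := by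
      rw [← mul_smul, mul_assoc, mul_inv_cancel, mul_one, hab']
    refine (hΛ _).2 ⟨Γ.mul_mem (Γ.inv_mem a.2) b.2, ?_⟩
    exact forall_apply_smul_eq_of_apply_smul_eq hp hk hpk hdeck (Γ.mul_mem (Γ.inv_mem a.2) b.2) key
  haveI : Finite (Γ ⧸ Λ.subgroupOf Γ) := Finite.of_injective F hF
  exact Subgroup.finiteIndex_of_finite_quotient

end SimplyConnectedCover

end Literature.Topology.CoveringSpaces
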